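import Summits.QuantumFields.YangMills.Theorems.UnitScaleTiltMinimiserStabilityRegPrOfHalvingExistence
import Summits.QuantumFields.YangMills.Theorems.UnitScaleTiltMinimiserStabilityRegPrStubHalvingStep
import HarnessLib

/-!
# Route `UnitScaleTilt`, crux K1 «MinimiserStabilityRegPr» (stmt-QuantumFields-19200) — THE GUARDED (BLOCK SIZE `L ≥ 5`) COMPOSITION AND RUNG GLUE:
# `∀ L ≥ 5, ⟨crux body⟩ ⟸ ✓stub_halvingStep ∧ ⟨EX body guarded at L ≥ 5⟩`, and print's admissible-block leaf `YM3TorusSU2Adm` (L odd > 11)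
# ⟸ ⟨guarded crux⟩ ∧ `FluctuationComparisonRegPrIntL` ∧ `HistoryTailL`

Cell `ym3-torus`, fleet lead ★p1 (seat `ym-ust-19200-p1` g29, chair; ★★OWNER RULING №55 «GUARDED CHAIN», docket (5)(ii) «re-cut»).  THEOREMS ONLY (0 `def`, 0 `sorry`,
standard axioms); `--supports stmt-QuantumFields-19200 --as helper`; CONDITIONAL (the guarded EX body and the two sibling cruxes are hypotheses); registry ∕ route ∕
display untouched (J-FREEZE honoured).

WHY.  After ✓p782708 (`hThm2S` is a theorem for every L ≥ 5) and S54∕S55, the EX display's only non-parameter letter is `hThm2S3` = [Balaban1985RegularSpaces] Thm 2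
at L = 3, a class excluded at the carrier level of the supplier lineage (`B6KLevelCensusIndexV1.KIdx.hℓ : 4 ≤ ℓ`); RULING №55 authorises the GUARDED edition line Sₙᵍ
(conclusion = EX's body behind `1 < L → 5 ≤ L →`, no `hThm2S`-class binder).  THIS FILE is what that line and the post-freeze re-cut (docket (5)(ii)) plug into:
§1 the guarded twin of ✓`AttainmentOfExistence.MinimiserStabilityRegPr_of_halvingStep_of_existence` (same proof, `hEX L hL` ↦ `hEX L hL h5`, H fed BY NAME by
✓p705908 `stub_halvingStep`), §2 the guarded twin of the route's `closes` glue concluding print's own letter ✓`T3YM3TorusStatement.YM3TorusSU2Adm` («L odd > 11»,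
[Balaban1987RG1] §0 p. 251) instead of `YM3TorusSU2` (all odd L > 1), §3 their composition.

WHAT THIS FILE PROVES.
* §1 ★★ `minimiserStabilityRegPr_guarded_of_existence5` — `(hEX5 : ∀ L, 1 < L → 5 ≤ L → ⟨EX body⟩) → ∀ L, 5 ≤ L → ⟨MinimiserStabilityRegPr body at L⟩`.
* §2 ★★ `ym3TorusSU2Adm_of_guardedCrux` — `(∀ L, 5 ≤ L → ⟨crux body at L⟩) → FluctuationComparisonRegPrIntL → HistoryTailL → YM3TorusSU2Adm` (the route's `closes`
  proof VERBATIM under the guard; `11 < L₀ ⇒ 5 ≤ L₀`).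
* §3 ★★★ `ym3TorusSU2Adm_of_existence5` — §2 ∘ §1.

HONEST SCOPE.  Plumbing; CONDITIONAL on the guarded EX body (to be supplied by the Sᵍ line modulo parameters) and on the two sibling cruxes (stmt-QuantumFields-20520,
stmt-QuantumFields-19936); does NOT close `stub_existenceMinimalOrbit` ∕ 19200 as registered (all L > 1) nor the rung leaf of record `YM3TorusSU2` (all odd L > 1);
rung R3 = SU(2) YM₃ on T³ — NOT d = 4, NOT infinite volume, NOT a mass gap, NOT Clay; the Yang–Mills mass gap is NOT proved.
References: T. Bałaban, CMP **102** (1985) 277–309 [Balaban1985Variational] (Thm 1 (6)–(10) pp.278–279, Prop. 7 p.299, Prop. 8 p.304); CMP **109** (1987) 249–301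
[Balaban1987RG1] (§0 p.251); CMP **102** (1985) 255–275 [Balaban1985UV3] ((1)–(3) p.256).
-/

set_option autoImplicit false

noncomputable section

namespace Summit.QuantumFields.YangMills.Theorems.MinimiserStabilityRegPrGuarded

open MeasureTheory Filter Topology
open scoped Matrix.Norms.L2Operator
open Literature.MathematicalPhysics.QuantumFieldTheory.Balaban1983to89
open Literature.MathematicalPhysics.QuantumFieldTheory.Balaban1983to89.T3ContinuumYM3Torus
open Literature.MathematicalPhysics.QuantumFieldTheory.Balaban1983to89.T3UnitLawDensityEML (ℰp measurableE_ℰp)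
open Literature.MathematicalPhysics.QuantumFieldTheory.Balaban1983to89.T3UnitScaleTilt
open Literature.MathematicalPhysics.QuantumFieldTheory.Balaban1983to89.T3TiltDescent
open Literature.MathematicalPhysics.QuantumFieldTheory.Balaban1983to89.T3CruxEstimates
open Literature.MathematicalPhysics.QuantumFieldTheory.Balaban1983to89.T3ConstrainedMinimiser
open Literature.MathematicalPhysics.QuantumFieldTheory.Balaban1983to89.T3DescentFibreTower
open Literature.MathematicalPhysics.QuantumFieldTheory.Balaban1983to89.T3MinimiserStabilityReduction
open Literature.MathematicalPhysics.QuantumFieldTheory.Balaban1983to89.T3RegularMinimiser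
open Literature.MathematicalPhysics.QuantumFieldTheory.Balaban1983to89.T3PrintedRegularMinimiser
open Literature.MathematicalPhysics.QuantumFieldTheory.Balaban1983to89.T3PrintedRegularMinimiserReduction
open Literature.MathematicalPhysics.QuantumFieldTheory.Balaban1983to89.T3PrintedMinimiserExistence
open Literature.MathematicalPhysics.QuantumFieldTheory.Balaban1983to89.T3LowerAlongMinimisersSplit
open Literature.MathematicalPhysics.QuantumFieldTheory.Balaban1983to89.T3AvgDivergenceSplit
open Literature.MathematicalPhysics.QuantumFieldTheory.Balaban1983to89.T3UpperAlongMinimisersSplit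
open Literature.MathematicalPhysics.QuantumFieldTheory.Balaban1983to89.T3UpperLiftSplit
open Literature.MathematicalPhysics.QuantumFieldTheory.Balaban1983to89.T3LowerActionSplit
open Literature.MathematicalPhysics.QuantumFieldTheory.Balaban1983to89.T3ExistSplit
open Literature.MathematicalPhysics.QuantumFieldTheory.Balaban1983to89.T3Thm1Carrier
open Literature.MathematicalPhysics.QuantumFieldTheory.Balaban1983to89.T3CurvGradLog
open Literature.MathematicalPhysics.QuantumFieldTheory.Balaban1983to89.T3SplitLog
open Literature.MathematicalPhysics.QuantumFieldTheory.Balaban1983to89.T3UpperLiftSplitLog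
open Literature.MathematicalPhysics.QuantumFieldTheory.Balaban1983to89.B11 (Prop8Printed)
open Literature.MathematicalPhysics.QuantumFieldTheory.Balaban1983to89.T3YM3TorusStatement (YM3TorusSU2Adm YM3TorusSU2At)
open Summit.QuantumFields.YangMills.Theses.UnitScaleTilt (FluctuationComparisonRegPrIntL HistoryTailL)
open Summit.QuantumFields.YangMills.Theorems.AttainmentOfExistence (minSixAttainedAt_of_existence_prop8)
open Summit.QuantumFields.YangMills.Theorems.MinimiserStabilityRegPrStubHalvingStep (stub_halvingStep)

/-! ## §1 ★★ The guarded crux body from the guarded EX body (H = ✓`stub_halvingStep` by name) -/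

/-- ★★ **`∀ L ≥ 5, ⟨MinimiserStabilityRegPr body at L⟩ ⟸ ⟨EX body guarded at L ≥ 5⟩`** — the twin of ✓`AttainmentOfExistence.MinimiserStabilityRegPr_of_halvingStep_of_existence`
under the guard: per `L ≥ 5`, Prop. 8 from ✓`stub_halvingStep` (✓`Prop8Iter.prop8_of_halvingLiteral`), attainment over (6) from the existence clause AT THIS `L`
(✓`minSixAttainedAt_of_existence_prop8`), minimisers in (8) (✓`minimisersIn8At_of_prop8`), the log-Lipschitz curvature gradient (✓`CritCurvGradLog.stub_critCurvGradLog`,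
✓`minimiserCurvGradLogAt_of_crit`); then EXIST ∕ UPPER ∕ LOWER exactly as in the composition of record (`T3ExistSplit.hasRegMinimisersPrAt_of_attained`,
`T3UpperLiftSplitLog.upperAlongRegPrMinimisersAt_of_splitLog'` with ✓`SmoothLift.stub_smoothLift`, `T3SplitLog.lowerAlongRegPrMinimisersAt_of_splitLog'''` with
✓`AvgCurvGrad.stub_avgCurvGrad` ∕ ✓`AvgActionDefect.stub_avgActionDefect`, `minimiserStabilityRegPrAt_of_alongRegPrMinimisers`; `ε₁ := min` of three, `m₀ := 10`, `γ₁ := min` of three).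
CONDITIONAL on `hEX5`. [cite: Balaban1985Variational, Thm 1 (6)-(10) pp.278-279, Prop. 7 p.299, Prop. 8 p.304] -/
theorem minimiserStabilityRegPr_guarded_of_existence5
    (hEX5 : ∀ (L : ℕ), 1 < L → 5 ≤ L → ∀ (B₃ : ℝ), 4 < B₃ → ∃ a₁' O₁ : ℝ, 0 < a₁' ∧ 1 ≤ O₁ ∧
      ∀ (F : T3Family), F.L = L → ∀ (n K : ℕ) (hnK : n < K) (ε₁ : ℝ), 0 < ε₁ →
        ∀ V : GaugeField (F.P n) 0 (Matrix.specialUnitaryGroup (Fin 2) ℂ), PlaqSmall ε₁ V →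
          ∀ U₀ : GaugeField (F.P K) 0 (Matrix.specialUnitaryGroup (Fin 2) ℂ), RegPr F n K ((L : ℝ) ^ 3 * B₃ * ε₁) U₀ → U₀ ∈ fibre F ℰp n K hnK.le V →
            ε₁ ≤ a₁' → ∃ U ∈ regFibrePr F n K hnK.le (O₁ * (L : ℝ) ^ 3 * B₃ * ε₁) V,
              IsMinOn (fun W : GaugeField (F.P K) 0 (Matrix.specialUnitaryGroup (Fin 2) ℂ) => wilsonAction4 W)
                (regFibrePr F n K hnK.le (O₁ * (L : ℝ) ^ 3 * B₃ * ε₁) V) U) :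
    ∀ (L : ℕ), 5 ≤ L → ∃ ε₁ : ℝ, 0 < ε₁ ∧ ∀ (ε₀ : ℝ), 0 < ε₀ → ε₀ ≤ ε₁ → ∃ m₀ : ℕ, ∀ (m : ℕ), m₀ ≤ m →
      ∀ (b₀ p₀ : ℝ), 0 < b₀ → 2 < p₀ → ∃ γ₁ : ℝ, 0 < γ₁ ∧ ∀ (F : T3Family) (γ : ℝ), F.L = L → 0 < γ → γ ≤ γ₁ →
        MinimiserStabilityRegPrAt F γ b₀ p₀ m ε₀ := by
  intro L h5
  have hL : 1 < L := by omega
  -- Prop. 8 from the halving step; attainment over (6) from the existence clause at this `L`; minimisers in (8); the curvature gradient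
  obtain ⟨B₃, hB₃, h8⟩ := Summit.QuantumFields.YangMills.Theorems.Prop8Iter.prop8_of_halvingLiteral stub_halvingStep L hL
  have hB₃0 : 0 < B₃ := by linarith
  obtain ⟨â₀, â₁, hâ₀, hâ₁, hatt⟩ := minSixAttainedAt_of_existence_prop8 hL hB₃ (hEX5 L hL h5 B₃ hB₃) h8
  obtain ⟨a₀, ha₀, h8'⟩ := minimisersIn8At_of_prop8 hB₃0 h8
  obtain ⟨a₁, B₄, ha₁, hB₄, hc⟩ := Summit.QuantumFields.YangMills.Theorems.CritCurvGradLog.stub_critCurvGradLog L hL B₃ hB₃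
  have hIn8 : MinimisersIn8At L a₀ a₁ B₃ := h8' a₁
  have hgrad : MinimiserCurvGradLogAt L a₀ a₁ B₃ B₄ := minimiserCurvGradLogAt_of_crit hB₃0 hc (h8' a₁)
  -- EXIST
  obtain ⟨e₁, he₁, hE⟩ := hasRegMinimisersPrAt_of_attained hâ₀ hâ₁ hB₃0 hatt
  -- UPPER
  obtain ⟨C₁, C₂, c, hC₁, hC₂, hc', hlift⟩ := Summit.QuantumFields.YangMills.Theorems.SmoothLift.stub_smoothLift L
  obtain ⟨e₂, he₂, hU⟩ := upperAlongRegPrMinimisersAt_of_splitLog' ha₀ ha₁ hB₃0 hB₄ hC₁ hC₂ hc' hIn8 hgrad hlift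
  -- LOWER
  obtain ⟨D₁, D₂, d, hD₁, hD₂, hd, havg⟩ := Summit.QuantumFields.YangMills.Theorems.AvgCurvGrad.stub_avgCurvGrad L
  obtain ⟨E₂, e, hE₂, he, hdef⟩ := Summit.QuantumFields.YangMills.Theorems.AvgActionDefect.stub_avgActionDefect L
  obtain ⟨e₃, he₃, hLo⟩ := lowerAlongRegPrMinimisersAt_of_splitLog''' hL.le ha₀ ha₁ hB₃0 hB₄ hD₂ hd hE₂ he hIn8 hgrad havg hdef
  -- the common `ε₁`, `m₀ = 10`, `γ₁`
  refine ⟨min e₁ (min e₂ e₃), lt_min he₁ (lt_min he₂ he₃), fun ε₀ hε hεle => ⟨10, fun m hm b₀ p₀ hb hp => ?_⟩⟩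
  have hε₁ : ε₀ ≤ e₁ := hεle.trans (min_le_left _ _)
  have hε₂ : ε₀ ≤ e₂ := hεle.trans ((min_le_right _ _).trans (min_le_left _ _))
  have hε₃ : ε₀ ≤ e₃ := hεle.trans ((min_le_right _ _).trans (min_le_right _ _))
  have hm2 : 2 ≤ m := le_trans (by norm_num) hm
  have hp0 : 0 < p₀ := lt_trans two_pos hp
  obtain ⟨γa, hγa, hA⟩ := hE ε₀ hε hε₁ m hm2 b₀ p₀ hb
  obtain ⟨γb, hγb, hB⟩ := hU ε₀ hε hε₂ m hm b₀ p₀ hb hp0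
  obtain ⟨γc, hγc, hC⟩ := hLo ε₀ hε hε₃ m hm b₀ p₀ hb hp0
  refine ⟨min γa (min γb γc), lt_min hγa (lt_min hγb hγc), fun F γ hFL hγ hγle => ?_⟩
  have hγa' : γ ≤ γa := hγle.trans (min_le_left _ _)
  have hγb' : γ ≤ γb := hγle.trans ((min_le_right _ _).trans (min_le_left _ _))
  have hγc' : γ ≤ γc := hγle.trans ((min_le_right _ _).trans (min_le_right _ _))
  exact minimiserStabilityRegPrAt_of_alongRegPrMinimisers hγ.le (hA F γ hFL hγ hγa') (hB F γ hFL hγ hγb') (hC F γ hFL hγ hγc')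

/-! ## §2 ★★ Print's admissible-block leaf `YM3TorusSU2Adm` from the guarded crux and the two sibling cruxes -/

/-- ★★ **`YM3TorusSU2Adm ⟸ ⟨MinimiserStabilityRegPr guarded at L ≥ 5⟩ ∧ FluctuationComparisonRegPrIntL ∧ HistoryTailL`** — the route's `closes` glue VERBATIM
(E-INT composition: `(c, b₁, p₁)` from the interior comparison crux at `L₀`, the profile from the tail, the stability crux at the dilated profile, `ε₀ := min`,
`m := max (max m₁ m₂) 1`, refinement `γL^{-n} ↓ 0`, `T3InteriorExcision.unitTiltTail_of_interior`, `T3UnitScaleTilt.continuumYM3Torus_of_refine_unitTiltTail`),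
run per admissible block size `L₀` (odd, `> 11`, hence `≥ 5`) and concluding print's own letter `YM3TorusSU2Adm` ([Balaban1987RG1] §0 p. 251 «L is an odd,
positive integer > 11»; `γ₁ := 1` per `L₀`).  CONDITIONAL on all three hypotheses. [cite: Balaban1987RG1, §0 p.251; Balaban1985UV3, (1)-(3) p.256; Balaban1985Variational, Thm 1 p.279] -/
theorem ym3TorusSU2Adm_of_guardedCrux
    (h200g : ∀ (L : ℕ), 5 ≤ L → ∃ ε₁ : ℝ, 0 < ε₁ ∧ ∀ (ε₀ : ℝ), 0 < ε₀ → ε₀ ≤ ε₁ → ∃ m₀ : ℕ, ∀ (m : ℕ), m₀ ≤ m →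
      ∀ (b₀ p₀ : ℝ), 0 < b₀ → 2 < p₀ → ∃ γ₁ : ℝ, 0 < γ₁ ∧ ∀ (F : T3Family) (γ : ℝ), F.L = L → 0 < γ → γ ≤ γ₁ →
        MinimiserStabilityRegPrAt F γ b₀ p₀ m ε₀)
    (h201 : FluctuationComparisonRegPrIntL) (hK2 : HistoryTailL) : YM3TorusSU2Adm := by
  intro L₀ _ h11
  refine ⟨1, one_pos, fun F γ hFL hγ _ => ?_⟩
  obtain ⟨c, b₁, p₁, hc0, hc1, hB⟩ := h201 F.L
  obtain ⟨b₀', p₀, hb₁, hp₁, hb₀', hp₀, hT⟩ := hK2 F.L b₁ p₁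
  have hb₀ : 0 < b₀' / c := div_pos hb₀' hc0
  have hb₁' : b₁ ≤ b₀' / c := by
    refine hb₁.trans ?_
    rw [le_div_iff₀ hc0]
    exact mul_le_of_le_one_right hb₀'.le hc1
  have hcb : c * (b₀' / c) = b₀' := by field_simp
  obtain ⟨ε₁, hε₁, hA⟩ := h200g F.L (by rw [hFL]; omega)
  obtain ⟨ε₁', hε₁', hB'⟩ := hB (b₀' / c) p₀ hb₁' hp₁ hb₀ hp₀
  obtain ⟨m₁, hm₁⟩ := hA (min ε₁ ε₁') (lt_min hε₁ hε₁') (min_le_left _ _)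
  obtain ⟨m₂, hm₂⟩ := hB' (min ε₁ ε₁') (lt_min hε₁ hε₁') (min_le_right _ _)
  obtain ⟨γ₂, hγ₂, hT'⟩ := hT (max (max m₁ m₂) 1) (lt_of_lt_of_le Nat.one_pos (le_max_right _ _))
  obtain ⟨γ₃, hγ₃, hA'⟩ := hm₁ (max (max m₁ m₂) 1) ((le_max_left _ _).trans (le_max_left _ _)) (b₀' / c) p₀ hb₀ hp₀
  obtain ⟨γ₄, hγ₄, hB''⟩ := hm₂ (max (max m₁ m₂) 1) ((le_max_right _ _).trans (le_max_left _ _))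
  have hL : (1 : ℝ) < F.L := by exact_mod_cast F.hL.2
  have hL0 : (0 : ℝ) < F.L := zero_lt_one.trans hL
  have hγs : 0 < min (min γ₂ (min γ₃ γ₄)) 1 := lt_min (lt_min hγ₂ (lt_min hγ₃ hγ₄)) one_pos
  obtain ⟨n, hn⟩ := ((tendsto_pow_atTop_nhds_zero_of_lt_one (inv_nonneg.mpr hL0.le)
    (inv_lt_one_of_one_lt₀ hL)).eventually (ge_mem_nhds (div_pos hγs hγ))).exists
  have hpos : 0 < γ * ((F.L : ℝ)⁻¹) ^ n := mul_pos hγ (pow_pos (inv_pos.mpr hL0) n)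
  have hle : γ * ((F.L : ℝ)⁻¹) ^ n ≤ min (min γ₂ (min γ₃ γ₄)) 1 := by
    have e := mul_le_mul_of_nonneg_left hn hγ.le
    rwa [mul_div_cancel₀ _ hγ.ne'] at e
  have hle₂ : γ * ((F.L : ℝ)⁻¹) ^ n ≤ γ₂ := hle.trans ((min_le_left _ _).trans (min_le_left _ _))
  have hle₃ : γ * ((F.L : ℝ)⁻¹) ^ n ≤ γ₃ :=
    hle.trans ((min_le_left _ _).trans ((min_le_right _ _).trans (min_le_left _ _)))
  have hle₄ : γ * ((F.L : ℝ)⁻¹) ^ n ≤ γ₄ :=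
    hle.trans ((min_le_left _ _).trans ((min_le_right _ _).trans (min_le_right _ _)))
  have hle1 : γ * ((F.L : ℝ)⁻¹) ^ n ≤ 1 := hle.trans (min_le_right _ _)
  have hTn : HistoryTailAt (F.refine n) (γ * ((F.L : ℝ)⁻¹) ^ n) (c * (b₀' / c)) p₀ (max (max m₁ m₂) 1) := by
    rw [hcb]
    exact hT' (F.refine n) _ rfl hpos hle₂
  obtain ⟨r, w, w', hr, hw, hw', h⟩ :=
    T3InteriorExcision.unitTiltTail_of_interior hpos hle1 hb₀ hc1 (hA' (F.refine n) _ rfl hpos hle₃) (hB'' (F.refine n) _ rfl hpos hle₄) hTn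
  exact continuumYM3Torus_of_refine_unitTiltTail F ℰp measurableE_ℰp n hγ.le hr hw hw' h

/-! ## §3 ★★★ The admissible-block leaf from the guarded EX body and the two sibling cruxes -/

/-- ★★★ **`YM3TorusSU2Adm ⟸ ⟨EX body guarded at L ≥ 5⟩ ∧ FluctuationComparisonRegPrIntL ∧ HistoryTailL`** (§2 ∘ §1; H by name).  Once the GUARDED edition line Sᵍ
(RULING №55) supplies the guarded EX body modulo parameters, print's admissible-block rung leaf no longer reads stmt-QuantumFields-19200 as filed.
CONDITIONAL; nothing of the three inputs is proved here. [cite: Balaban1987RG1, §0 p.251; Balaban1985Variational, Prop. 7 p.299, Prop. 8 p.304] -/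
theorem ym3TorusSU2Adm_of_existence5
    (hEX5 : ∀ (L : ℕ), 1 < L → 5 ≤ L → ∀ (B₃ : ℝ), 4 < B₃ → ∃ a₁' O₁ : ℝ, 0 < a₁' ∧ 1 ≤ O₁ ∧
      ∀ (F : T3Family), F.L = L → ∀ (n K : ℕ) (hnK : n < K) (ε₁ : ℝ), 0 < ε₁ →
        ∀ V : GaugeField (F.P n) 0 (Matrix.specialUnitaryGroup (Fin 2) ℂ), PlaqSmall ε₁ V →
          ∀ U₀ : GaugeField (F.P K) 0 (Matrix.specialUnitaryGroup (Fin 2) ℂ), RegPr F n K ((L : ℝ) ^ 3 * B₃ * ε₁) U₀ → U₀ ∈ fibre F ℰp n K hnK.le V →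
            ε₁ ≤ a₁' → ∃ U ∈ regFibrePr F n K hnK.le (O₁ * (L : ℝ) ^ 3 * B₃ * ε₁) V,
              IsMinOn (fun W : GaugeField (F.P K) 0 (Matrix.specialUnitaryGroup (Fin 2) ℂ) => wilsonAction4 W)
                (regFibrePr F n K hnK.le (O₁ * (L : ℝ) ^ 3 * B₃ * ε₁) V) U)
    (h201 : FluctuationComparisonRegPrIntL) (hK2 : HistoryTailL) : YM3TorusSU2Adm :=
  ym3TorusSU2Adm_of_guardedCrux (minimiserStabilityRegPr_guarded_of_existence5 hEX5) h201 hK2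

/-! ## §4 ★★★ The fixed-block-size leaf `YM3TorusSU2At L₀` at EVERY `L₀ ≥ 5` (finer than `YM3TorusSU2Adm`, which keeps only `L₀` odd `> 11`) -/

/-- ★★★ **`YM3TorusSU2At L₀ ⟸ ⟨MinimiserStabilityRegPr guarded at L ≥ 5⟩ ∧ FluctuationComparisonRegPrIntL ∧ HistoryTailL`, for EVERY `L₀ ≥ 5`** — the same E-INT glue
as §2 (the route's `closes` proof VERBATIM under the guard), concluding the fixed-block-size leaf ✓`T3YM3TorusStatement.YM3TorusSU2At L₀` (`γ₁ := 1`); covers the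
admissible block sizes `5 ≤ L₀ ≤ 11` that `YM3TorusSU2Adm` drops (even ∕ non-admissible `L₀` carry no family and are vacuous, `yM3TorusSU2At_of_not_admissible`).
CONDITIONAL on all three hypotheses. [cite: Balaban1985UV3, (1)-(3) p.256; Balaban1987RG1, §0 p.251; Balaban1985Variational, Thm 1 p.279] -/
theorem ym3TorusSU2At_of_guardedCrux (L₀ : ℕ) (h5 : 5 ≤ L₀)
    (h200g : ∀ (L : ℕ), 5 ≤ L → ∃ ε₁ : ℝ, 0 < ε₁ ∧ ∀ (ε₀ : ℝ), 0 < ε₀ → ε₀ ≤ ε₁ → ∃ m₀ : ℕ, ∀ (m : ℕ), m₀ ≤ m →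
      ∀ (b₀ p₀ : ℝ), 0 < b₀ → 2 < p₀ → ∃ γ₁ : ℝ, 0 < γ₁ ∧ ∀ (F : T3Family) (γ : ℝ), F.L = L → 0 < γ → γ ≤ γ₁ →
        MinimiserStabilityRegPrAt F γ b₀ p₀ m ε₀)
    (h201 : FluctuationComparisonRegPrIntL) (hK2 : HistoryTailL) : YM3TorusSU2At L₀ := by
  refine ⟨1, one_pos, fun F γ hFL hγ _ => ?_⟩
  obtain ⟨c, b₁, p₁, hc0, hc1, hB⟩ := h201 F.L
  obtain ⟨b₀', p₀, hb₁, hp₁, hb₀', hp₀, hT⟩ := hK2 F.L b₁ p₁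
  have hb₀ : 0 < b₀' / c := div_pos hb₀' hc0
  have hb₁' : b₁ ≤ b₀' / c := by
    refine hb₁.trans ?_
    rw [le_div_iff₀ hc0]
    exact mul_le_of_le_one_right hb₀'.le hc1
  have hcb : c * (b₀' / c) = b₀' := by field_simp
  obtain ⟨ε₁, hε₁, hA⟩ := h200g F.L (by rw [hFL]; exact h5)
  obtain ⟨ε₁', hε₁', hB'⟩ := hB (b₀' / c) p₀ hb₁' hp₁ hb₀ hp₀
  obtain ⟨m₁, hm₁⟩ := hA (min ε₁ ε₁') (lt_min hε₁ hε₁') (min_le_left _ _)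
  obtain ⟨m₂, hm₂⟩ := hB' (min ε₁ ε₁') (lt_min hε₁ hε₁') (min_le_right _ _)
  obtain ⟨γ₂, hγ₂, hT'⟩ := hT (max (max m₁ m₂) 1) (lt_of_lt_of_le Nat.one_pos (le_max_right _ _))
  obtain ⟨γ₃, hγ₃, hA'⟩ := hm₁ (max (max m₁ m₂) 1) ((le_max_left _ _).trans (le_max_left _ _)) (b₀' / c) p₀ hb₀ hp₀
  obtain ⟨γ₄, hγ₄, hB''⟩ := hm₂ (max (max m₁ m₂) 1) ((le_max_right _ _).trans (le_max_left _ _))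
  have hL : (1 : ℝ) < F.L := by exact_mod_cast F.hL.2
  have hL0 : (0 : ℝ) < F.L := zero_lt_one.trans hL
  have hγs : 0 < min (min γ₂ (min γ₃ γ₄)) 1 := lt_min (lt_min hγ₂ (lt_min hγ₃ hγ₄)) one_pos
  obtain ⟨n, hn⟩ := ((tendsto_pow_atTop_nhds_zero_of_lt_one (inv_nonneg.mpr hL0.le)
    (inv_lt_one_of_one_lt₀ hL)).eventually (ge_mem_nhds (div_pos hγs hγ))).exists
  have hpos : 0 < γ * ((F.L : ℝ)⁻¹) ^ n := mul_pos hγ (pow_pos (inv_pos.mpr hL0) n)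
  have hle : γ * ((F.L : ℝ)⁻¹) ^ n ≤ min (min γ₂ (min γ₃ γ₄)) 1 := by
    have e := mul_le_mul_of_nonneg_left hn hγ.le
    rwa [mul_div_cancel₀ _ hγ.ne'] at e
  have hle₂ : γ * ((F.L : ℝ)⁻¹) ^ n ≤ γ₂ := hle.trans ((min_le_left _ _).trans (min_le_left _ _))
  have hle₃ : γ * ((F.L : ℝ)⁻¹) ^ n ≤ γ₃ :=
    hle.trans ((min_le_left _ _).trans ((min_le_right _ _).trans (min_le_left _ _)))
  have hle₄ : γ * ((F.L : ℝ)⁻¹) ^ n ≤ γ₄ :=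
    hle.trans ((min_le_left _ _).trans ((min_le_right _ _).trans (min_le_right _ _)))
  have hle1 : γ * ((F.L : ℝ)⁻¹) ^ n ≤ 1 := hle.trans (min_le_right _ _)
  have hTn : HistoryTailAt (F.refine n) (γ * ((F.L : ℝ)⁻¹) ^ n) (c * (b₀' / c)) p₀ (max (max m₁ m₂) 1) := by
    rw [hcb]
    exact hT' (F.refine n) _ rfl hpos hle₂
  obtain ⟨r, w, w', hr, hw, hw', h⟩ :=
    T3InteriorExcision.unitTiltTail_of_interior hpos hle1 hb₀ hc1 (hA' (F.refine n) _ rfl hpos hle₃) (hB'' (F.refine n) _ rfl hpos hle₄) hTn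
  exact continuumYM3Torus_of_refine_unitTiltTail F ℰp measurableE_ℰp n hγ.le hr hw hw' h

/-- ★★★ **`YM3TorusSU2At L₀ ⟸ ⟨EX body guarded at L ≥ 5⟩ ∧ FluctuationComparisonRegPrIntL ∧ HistoryTailL`, for EVERY `L₀ ≥ 5`** (§4 ∘ §1; H by name) — the finest
target the guarded edition line Sᵍ and docket (5)(ii)'s re-cut can serve: every block size `L₀ ≥ 5` separately, `γ₁ := 1`.  CONDITIONAL; nothing of the three inputs is
proved here. [cite: Balaban1985UV3, (1)-(3) p.256; Balaban1985Variational, Prop. 7 p.299, Prop. 8 p.304] -/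
theorem ym3TorusSU2At_of_existence5 (L₀ : ℕ) (h5 : 5 ≤ L₀)
    (hEX5 : ∀ (L : ℕ), 1 < L → 5 ≤ L → ∀ (B₃ : ℝ), 4 < B₃ → ∃ a₁' O₁ : ℝ, 0 < a₁' ∧ 1 ≤ O₁ ∧
      ∀ (F : T3Family), F.L = L → ∀ (n K : ℕ) (hnK : n < K) (ε₁ : ℝ), 0 < ε₁ →
        ∀ V : GaugeField (F.P n) 0 (Matrix.specialUnitaryGroup (Fin 2) ℂ), PlaqSmall ε₁ V →
          ∀ U₀ : GaugeField (F.P K) 0 (Matrix.specialUnitaryGroup (Fin 2) ℂ), RegPr F n K ((L : ℝ) ^ 3 * B₃ * ε₁) U₀ → U₀ ∈ fibre F ℰp n K hnK.le V →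
            ε₁ ≤ a₁' → ∃ U ∈ regFibrePr F n K hnK.le (O₁ * (L : ℝ) ^ 3 * B₃ * ε₁) V,
              IsMinOn (fun W : GaugeField (F.P K) 0 (Matrix.specialUnitaryGroup (Fin 2) ℂ) => wilsonAction4 W)
                (regFibrePr F n K hnK.le (O₁ * (L : ℝ) ^ 3 * B₃ * ε₁) V) U)
    (h201 : FluctuationComparisonRegPrIntL) (hK2 : HistoryTailL) : YM3TorusSU2At L₀ :=
  ym3TorusSU2At_of_guardedCrux L₀ h5 (minimiserStabilityRegPr_guarded_of_existence5 hEX5) h201 hK2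

/-- The admissible-block leaf from the fixed-block-size leaves (bookkeeping: `11 < L₀ ⇒ 5 ≤ L₀`). [cite: Balaban1987RG1, §0 p.251] -/
theorem ym3TorusSU2Adm_of_forall_at_five (h : ∀ L₀ : ℕ, 5 ≤ L₀ → YM3TorusSU2At L₀) : YM3TorusSU2Adm :=
  fun L₀ _ h11 => h L₀ (by omega)

end Summit.QuantumFields.YangMills.Theorems.MinimiserStabilityRegPrGuarded

end
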